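import Summits.HodgeConjecture.HodgeConjecture.Theorems.K2E3GL3TwoBlockInducedIrreducible
import Summits.HodgeConjecture.HodgeConjecture.Theorems.K2E3GL3OuterAutomorphismInduction
import Summits.HodgeConjecture.HodgeConjecture.Theorems.K2E3GL3CuspidalBlockRestriction
import Summits.HodgeConjecture.HodgeConjecture.Theorems.K2E3GL3MaximalParabolicRelabel
import Summits.HodgeConjecture.HodgeConjecture.Theorems.K2E3GL3InductionInStagesEmbedding
import Literature.NumberTheory.Automorphic.ParabolicGLReindex
import Literature.NumberTheory.Automorphic.RestrictedTensorProductIrreducibleProofs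
import Literature.NumberTheory.Automorphic.IrreducibleClasses
import Literature.NumberTheory.Automorphic.SupercuspidalSubrep
import Literature.NumberTheory.Automorphic.ParabolicInductionQuotientProofs
import Literature.NumberTheory.Automorphic.ParabolicInductionAdmissibleProofs
import Literature.NumberTheory.Automorphic.Liu2021.LemD1SplitPlaceOfFacts
import HarnessLib

/-!
# R90-TF · S1 #7, SUPERCUSPIDAL CASE — `Ind_{P₍₂,₁₎}^{GL₃(F)}(σ₂ ⊠ χ′)` is irreducible for `σ₂` irreducible smooth supercuspidal on `GL₂(F)`

Cell `hodgecm-mathlib`, programme R90-TF, section S1 «Ch10-local», seat R90-C10-p01 (g0); helper for the socket S1#7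
`stub_S1_split_parabolicInd_irreducible_of_unitary` (`Cruxes/H413/Lines/R90_S1_SplitLocalPacketsB.lean`), consumed by
`Theorems/R90S1SplitInducedIrreducibleBox`.  THEOREMS ONLY (one public theorem, one private helper); no definition, no named fact, no `sorry`.

THE MATHEMATICS ([Zelevinsky1980, Thm. 4.2]; [BernsteinZelevinsky1977, Thm. 4.2, §2.3]).  The Levi datum `σ₂ ⊠ χ′` of ★ in-stages' `box` currency (labelling
`![false,false,true]`, `σ₂` read on the `GL₂`-block along `reindexGL e`) is pulled back to the labelling `![0,0,1]` along ★ `leviReindexHom`; there it is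
irreducible, smooth and — through the block equivalence ★ `exists_continuousMulEquiv_levi_two_one` `GL₂(F) × GL₁(F) ≃ M` and the private lemma
`isSupercuspidal_comp_fst` («`σ ∘ fst` is supercuspidal on `G₁ × A`», `A` commutative) — SUPERCUSPIDAL, so ★ `K2E3GL3TwoBlockInducedIrreducible.isIrreducible_parabolicIndGL_twoOne`
(`ρ × χ` irreducible for supercuspidal `ρ`) applies; ★ `isIrreducible_parabolicIndGL_iff_of_continuousMulEquiv` (identity of `GL₃(F)`, `P₍₂,₁₎` is the same
subgroup in both labellings ★ `standardParabolicGL_eq_lastBlockLabel`) transports irreducibility back.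
HONEST LABEL: HC_CM is proved only modulo the 7 printed citations (2 remaining named inputs: hLiu418 = stmt-HodgeConjecture-24832,
h413 = stmt-HodgeConjecture-24833) until rung 0 closes; count-neutral helper (`--supports stmt-HodgeConjecture-24833 --as helper`).
-/

set_option autoImplicit false
set_option linter.dupNamespace false

noncomputable section

open MeasureTheory Measure Set Filter Topology
open scoped NNReal ENNReal ComplexConjugate

namespace Summit.HodgeConjecture.HodgeConjecture.R90.S1

open Literature.NumberTheory Literature.NumberTheory.Automorphic

section Supercuspidal

open Summit.HodgeConjecture.HodgeConjecture.Cruxes.H413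
open Literature.NumberTheory.GaloisRepresentations Literature.NumberTheory.GaloisRepresentations.IsNonarchimedeanLocalField

/-- **`σ ∘ fst` is supercuspidal on `G₁ × A` when `σ` is supercuspidal on `G₁` and `A` is commutative**: a smooth form for `σ ∘ fst` is smooth for `σ`
(its stabiliser contains the slice `Stab ∩ (G₁ × 1)`), and the support of a coefficient is `supp(c_σ) × A ⊆ (C × 1) · (Z(G₁) × A) ⊆ (C × 1) · Z(G₁ × A)`.
[cite: BushnellHenniart2006, §10.1] [cite: HarishChandra1970, Part I §3 p. 9] -/
private theorem isSupercuspidal_comp_fst {G₁ A : Type*} [Group G₁] [TopologicalSpace G₁] [IsTopologicalGroup G₁] [Group A] [TopologicalSpace A]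
    [IsTopologicalGroup A] (hA : ∀ a b : A, a * b = b * a) {V : Type*} [AddCommGroup V] [Module ℂ V] {σ : Representation ℂ G₁ V}
    (hsc : σ.IsSupercuspidal) : Representation.IsSupercuspidal (σ.comp (MonoidHom.fst G₁ A)) := by
  intro φ hφ v
  -- `φ` is a smooth form for `σ`
  have hφ' : φ ∈ σ.contragredient := by
    rw [Representation.mem_contragredient] at hφ ⊢
    have hS : IsOpen (((Representation.dual (σ.comp (MonoidHom.fst G₁ A))).stabilizerSubgroup φ : Subgroup (G₁ × A)) : Set (G₁ × A)) := hφ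
    refine Subgroup.isOpen_mono (H₁ := ((Representation.dual (σ.comp (MonoidHom.fst G₁ A))).stabilizerSubgroup φ).comap (MonoidHom.inl G₁ A)) ?_
      (hS.preimage (continuous_id.prodMk continuous_const))
    intro g hg
    rw [Subgroup.mem_comap, Representation.mem_stabilizerSubgroup] at hg
    rw [Representation.mem_stabilizerSubgroup]
    refine LinearMap.ext fun w => ?_
    have hg' := LinearMap.congr_fun hg w
    simp only [Representation.dual_apply, Module.Dual.transpose_apply, LinearMap.comp_apply, MonoidHom.comp_apply] at hg' ⊢
    have hinv : ((MonoidHom.inl G₁ A g) : G₁ × A)⁻¹ = (g⁻¹, 1) := by simp [MonoidHom.inl_apply]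
    rw [hinv] at hg'
    exact hg'
  obtain ⟨C, hC, hsupp⟩ := hsc φ hφ' v
  refine ⟨(fun g : G₁ => ((g, 1) : G₁ × A)) '' C, hC.image (continuous_id.prodMk continuous_const), fun x hx => ?_⟩
  have hx' : x.1 ∈ Function.support (σ.matrixCoeff φ v) := by
    rw [Function.mem_support] at hx ⊢
    simpa only [Representation.matrixCoeff_apply, MonoidHom.comp_apply, MonoidHom.coe_fst] using hx
  obtain ⟨c, hc, z, hz, hcz⟩ := Set.mem_mul.1 (hsupp hx')
  refine Set.mem_mul.2 ⟨(c, 1), ⟨c, hc, rfl⟩, (z, x.2), ?_, ?_⟩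
  · rw [SetLike.mem_coe, Subgroup.mem_center_iff]
    intro y
    have hz' := Subgroup.mem_center_iff.1 hz y.1
    ext
    · simpa using hz'
    · simpa using hA y.2 x.2
  · ext
    · simpa using hcz
    · simp

variable {F : Type} [Field F] [ValuativeRel F] [TopologicalSpace F] [IsNonarchimedeanLocalField F]

set_option maxHeartbeats 400000 in
/-- **S1#7, SUPERCUSPIDAL `σ₂`.**  For an irreducible smooth SUPERCUSPIDAL `σ₂` of `GL₂(F)` and a continuous character `χ′`, `Ind_{P₍₂,₁₎}^{GL₃(F)}(σ₂ ⊠ χ′)`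
(★ in-stages' `box σ₂ χ′` along a block equivalence `e`, labelling `![false,false,true]`) is IRREDUCIBLE: the Levi datum read on the labelling `![0,0,1]` along
★ `leviReindexHom` is irreducible, smooth and supercuspidal (the latter via the block equivalence ★ `exists_continuousMulEquiv_levi_two_one`
`GL₂ × GL₁ ≃ M` and `isSupercuspidal_comp_fst`), so ★ `K2E3GL3TwoBlockInducedIrreducible.isIrreducible_parabolicIndGL_twoOne` applies, and ★
`isIrreducible_parabolicIndGL_iff_of_continuousMulEquiv` (identity of `GL₃(F)`) carries irreducibility back to the labelling `![false,false,true]`.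
[cite: Zelevinsky1980, Thm. 4.2 p. 184] [cite: BernsteinZelevinsky1977, Thm. 4.2, §2.3] [cite: Rogawski1990, §13.3 p. 201] -/
theorem isIrreducible_parabolicIndGL_box_of_isSupercuspidal
    (e : Fin 2 ≃ {i : Fin 3 // (![false, false, true] : Fin 3 → Bool) i = false})
    (he : ∀ j : Fin 2, ((e j : {i : Fin 3 // (![false, false, true] : Fin 3 → Bool) i = false}) : Fin 3) = Fin.castSucc j)
    [LocallyCompactSpace (standardParabolicGL F (![false, false, true] : Fin 3 → Bool))]
    {W : Type} [AddCommGroup W] [Module ℂ W] (σ₂ : Representation ℂ (GL (Fin 2) F) W)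
    (hσi : σ₂.IsIrreducible) (hσs : σ₂.IsSmooth) (hsc : σ₂.IsSupercuspidal)
    (χ' : Fˣ →* ℂˣ) (hχ'c : Continuous fun t => ((χ' t : ℂˣ) : ℂ)) :
    (Representation.parabolicIndGL F (![false, false, true] : Fin 3 → Bool)
      (Representation.twist ((σ₂.comp (reindexGL e).symm.toMonoidHom).comp
        (Pi.evalMonoidHom (fun a : Bool => GL {i : Fin 3 // (![false, false, true] : Fin 3 → Bool) i = a} F) false))
        ((χ'.comp Matrix.GeneralLinearGroup.det).comp
          (Pi.evalMonoidHom (fun a : Bool => GL {i : Fin 3 // (![false, false, true] : Fin 3 → Bool) i = a} F) true)))).IsIrreducible := by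
  classical
  haveI := hσi
  haveI : Nontrivial W := Representation.IsIrreducible.nontrivial σ₂
  have hχ'o : IsOpen ((χ'.ker : Subgroup Fˣ) : Set Fˣ) := Liu2021.SplitPlace.isOpen_ker_of_continuous χ' hχ'c
  -- the Levi datum `τ = σ₂ ⊠ χ′`
  set τ : Representation ℂ (Π a : Bool, GL {i : Fin 3 // (![false, false, true] : Fin 3 → Bool) i = a} F) W :=
    Representation.twist ((σ₂.comp (reindexGL e).symm.toMonoidHom).comp
      (Pi.evalMonoidHom (fun a : Bool => GL {i : Fin 3 // (![false, false, true] : Fin 3 → Bool) i = a} F) false))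
      ((χ'.comp Matrix.GeneralLinearGroup.det).comp
        (Pi.evalMonoidHom (fun a : Bool => GL {i : Fin 3 // (![false, false, true] : Fin 3 → Bool) i = a} F) true)) with hτ
  have hτ_apply : ∀ (m : Π a : Bool, GL {i : Fin 3 // (![false, false, true] : Fin 3 → Bool) i = a} F) (w : W),
      τ m w = ((χ' (Matrix.GeneralLinearGroup.det (m true)) : ℂˣ) : ℂ) • σ₂ ((reindexGL e).symm (m false)) w := fun m w => rfl
  have hrc : Continuous ((reindexGL e).symm : GL {i : Fin 3 // (![false, false, true] : Fin 3 → Bool) i = false} F → GL (Fin 2) F) := by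
    haveI : IsTopologicalRing F := inferInstance
    exact Units.continuous_map (f := (Matrix.reindexAlgEquiv F F e.symm).toMulEquiv.toMonoidHom) (continuous_id.matrix_reindex e.symm e.symm)
  have hτs : τ.IsSmooth := by
    intro w
    have h1 : IsOpen ((σ₂.stabilizerSubgroup w : Set (GL (Fin 2) F))) := hσs w
    have hdet : Continuous fun m : (Π a : Bool, GL {i : Fin 3 // (![false, false, true] : Fin 3 → Bool) i = a} F) =>
        Matrix.GeneralLinearGroup.det (m true) := Matrix.GeneralLinearGroup.continuous_det.comp (continuous_apply true)
    have hker : IsOpen ((fun m : (Π a : Bool, GL {i : Fin 3 // (![false, false, true] : Fin 3 → Bool) i = a} F) =>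
        Matrix.GeneralLinearGroup.det (m true)) ⁻¹' ((χ'.ker : Subgroup Fˣ) : Set Fˣ)) := hχ'o.preimage hdet
    have hpre : IsOpen ((fun m : (Π a : Bool, GL {i : Fin 3 // (![false, false, true] : Fin 3 → Bool) i = a} F) =>
        (reindexGL e).symm (m false)) ⁻¹' (σ₂.stabilizerSubgroup w : Set (GL (Fin 2) F))) :=
      h1.preimage (hrc.comp (continuous_apply false))
    refine Subgroup.isOpen_mono (H₁ := ((χ'.ker : Subgroup Fˣ).comap (Matrix.GeneralLinearGroup.det.comp
      (Pi.evalMonoidHom (fun a : Bool => GL {i : Fin 3 // (![false, false, true] : Fin 3 → Bool) i = a} F) true))) ⊓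
      ((σ₂.stabilizerSubgroup w).comap ((reindexGL e).symm.toMonoidHom.comp
        (Pi.evalMonoidHom (fun a : Bool => GL {i : Fin 3 // (![false, false, true] : Fin 3 → Bool) i = a} F) false)))) ?_
      (hker.inter hpre)
    intro m hm
    obtain ⟨hm1, hm2⟩ := Subgroup.mem_inf.1 hm
    rw [Subgroup.mem_comap] at hm1 hm2
    rw [Representation.mem_stabilizerSubgroup] at hm2 ⊢
    rw [hτ_apply]
    have h1' : χ' (Matrix.GeneralLinearGroup.det (m true)) = 1 := hm1
    rw [h1', Units.val_one, one_smul]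
    exact hm2
  -- relabel to `![0,0,1]` and use ★ `isIrreducible_parabolicIndGL_twoOne`
  have hcc : ∀ i j : Fin 3, (![0, 0, 1] : Fin 3 → Fin 2) i < (![0, 0, 1] : Fin 3 → Fin 2) j ↔
      (![false, false, true] : Fin 3 → Bool) ((Equiv.refl (Fin 3)) i) <
        (![false, false, true] : Fin 3 → Bool) ((Equiv.refl (Fin 3)) j) := by decide
  -- the relabelling homomorphism of Levi factors `Θ' : M_{![0,0,1]} → M_{![f,f,t]}`
  have hΘsurj := leviReindexHom_surjective F (![false, false, true] : Fin 3 → Bool) (Equiv.refl (Fin 3))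
    (![0, 0, 1] : Fin 3 → Fin 2) hcc
  have hΘcont := continuous_leviReindexHom F (![false, false, true] : Fin 3 → Bool) (Equiv.refl (Fin 3))
    (![0, 0, 1] : Fin 3 → Fin 2) hcc
  -- `τ` is irreducible
  haveI hτi : τ.IsIrreducible := by
    have hp₀ : Function.Surjective ((reindexGL e).symm.toMonoidHom.comp
        (Pi.evalMonoidHom (fun a : Bool => GL {i : Fin 3 // (![false, false, true] : Fin 3 → Bool) i = a} F) false)) :=
      (reindexGL e).symm.surjective.comp (Function.surjective_eval false)
    haveI := Literature.NumberTheory.Automorphic.isIrreducible_comp_of_surjective σ₂ _ hp₀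
    exact Representation.isIrreducible_twist _ _
  haveI hτ''i : Representation.IsIrreducible (τ.comp (leviReindexHom F (![false, false, true] : Fin 3 → Bool) (Equiv.refl (Fin 3))
      (![0, 0, 1] : Fin 3 → Fin 2) hcc)) :=
    Literature.NumberTheory.Automorphic.isIrreducible_comp_of_surjective τ _ hΘsurj
  have hτ''s : Representation.IsSmooth (τ.comp (leviReindexHom F (![false, false, true] : Fin 3 → Bool) (Equiv.refl (Fin 3))
      (![0, 0, 1] : Fin 3 → Fin 2) hcc)) :=
    Literature.NumberTheory.Automorphic.IsSmooth.comp_of_continuous τ _ hΘcont hτs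
  -- `reindexGL (refl) = id` and the compatibility of `Θ'` with the two Levi projections
  have hrefl : ∀ g : GL (Fin 3) F, reindexGL (k := F) (Equiv.refl (Fin 3)) g = g := fun g =>
    Units.ext (by simp [coe_reindexGL])
  have hP : ∀ g : GL (Fin 3) F, (ContinuousMulEquiv.refl (GL (Fin 3) F)) g ∈ standardParabolicGL F (![0, 0, 1] : Fin 3 → Fin 2) ↔
      g ∈ standardParabolicGL F (![false, false, true] : Fin 3 → Bool) := by
    intro g
    rw [K2E3GL3MaximalParabolicRelabel.standardParabolicGL_eq_lastBlockLabel, K2E3GL3MaximalParabolicRelabel.lastBlockLabel_three]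
    exact Iff.rfl
  have hcompat : ∀ p : ↥(standardParabolicGL F (![false, false, true] : Fin 3 → Bool)),
      (τ.comp (leviReindexHom F (![false, false, true] : Fin 3 → Bool) (Equiv.refl (Fin 3)) (![0, 0, 1] : Fin 3 → Fin 2) hcc))
        (leviProjection F (![0, 0, 1] : Fin 3 → Fin 2) ⟨(ContinuousMulEquiv.refl (GL (Fin 3) F)) p, (hP p).2 p.2⟩) =
      τ (leviProjection F (![false, false, true] : Fin 3 → Bool) p) := by
    intro p
    rw [MonoidHom.comp_apply, ← leviProjection_parabolicReindex]
    exact congrArg (fun q => τ (leviProjection F (![false, false, true] : Fin 3 → Bool) q)) (Subtype.ext (hrefl _))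
  -- supercuspidality of `τ ∘ Θ'` via the block equivalence `E : GL₂ × GL₁ ≃ M_{![0,0,1]}`
  obtain ⟨E, hE⟩ := K2E3GL3CuspidalBlockRestriction.exists_continuousMulEquiv_levi_two_one F
  set ξ : GL (Fin 2) F × GL (Fin 1) F →* ℂˣ := (χ'.comp Matrix.GeneralLinearGroup.det).comp (MonoidHom.snd _ _) with hξ
  have hξo : IsOpen ((ξ.ker : Subgroup (GL (Fin 2) F × GL (Fin 1) F)) : Set (GL (Fin 2) F × GL (Fin 1) F)) := by
    have hc : Continuous fun x : GL (Fin 2) F × GL (Fin 1) F => Matrix.GeneralLinearGroup.det x.2 :=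
      Matrix.GeneralLinearGroup.continuous_det.comp continuous_snd
    have : ((ξ.ker : Subgroup (GL (Fin 2) F × GL (Fin 1) F)) : Set (GL (Fin 2) F × GL (Fin 1) F)) =
        (fun x : GL (Fin 2) F × GL (Fin 1) F => Matrix.GeneralLinearGroup.det x.2) ⁻¹' ((χ'.ker : Subgroup Fˣ) : Set Fˣ) := by
      ext x
      rw [SetLike.mem_coe, MonoidHom.mem_ker, Set.mem_preimage, SetLike.mem_coe, MonoidHom.mem_ker, hξ]
      rfl
    rw [this]
    exact hχ'o.preimage hc
  have hρE : ∀ (xx : GL (Fin 2) F × GL (Fin 1) F) (w : W),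
      (τ.comp (leviReindexHom F (![false, false, true] : Fin 3 → Bool) (Equiv.refl (Fin 3)) (![0, 0, 1] : Fin 3 → Fin 2) hcc)) (E xx) w =
        ((ξ xx : ℂˣ) : ℂ) • σ₂ xx.1 w := by
    intro xx w
    obtain ⟨m, hEm, hmat⟩ := hE xx
    have hmB : (m : GL (Fin 3) F) ∈ standardParabolicGL F (![false, false, true] : Fin 3 → Bool) := (hP m).1 m.2
    have h1 := hcompat ⟨m, hmB⟩
    have hm' : (⟨(ContinuousMulEquiv.refl (GL (Fin 3) F)) ((⟨(m : GL (Fin 3) F), hmB⟩ : ↥(standardParabolicGL F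
        (![false, false, true] : Fin 3 → Bool))) : GL (Fin 3) F), (hP _).2 hmB⟩ : ↥(standardParabolicGL F (![0, 0, 1] : Fin 3 → Fin 2))) = m :=
      Subtype.ext rfl
    rw [hm'] at h1
    rw [hEm, h1, hτ_apply]
    -- the two blocks of `m`
    have hdet : Matrix.GeneralLinearGroup.det (leviProjection F (![false, false, true] : Fin 3 → Bool) ⟨(m : GL (Fin 3) F), hmB⟩ true) =
        Matrix.GeneralLinearGroup.det xx.2 := by
      haveI hsub := K2E3GL3InductionInStagesEmbedding.subsingleton_block_true
      let i₂ : {i : Fin 3 // (![false, false, true] : Fin 3 → Bool) i = true} := ⟨2, by decide⟩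
      haveI : Unique {i : Fin 3 // (![false, false, true] : Fin 3 → Bool) i = true} := ⟨⟨i₂⟩, fun v => Subsingleton.elim _ _⟩
      have hd : (default : {i : Fin 3 // (![false, false, true] : Fin 3 → Bool) i = true}) = i₂ := Subsingleton.elim _ _
      refine Units.ext ?_
      rw [Matrix.GeneralLinearGroup.val_det_apply, Matrix.det_unique, Matrix.GeneralLinearGroup.val_det_apply, Matrix.det_unique,
        leviProjection_apply_coe, hd]
      change ((m : GL (Fin 3) F) : Matrix (Fin 3) (Fin 3) F) 2 2 = ((xx.2 : GL (Fin 1) F) : Matrix (Fin 1) (Fin 1) F) default default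
      rw [hmat, Fin.default_eq_zero]
      rfl
    have hblk : (reindexGL e).symm (leviProjection F (![false, false, true] : Fin 3 → Bool) ⟨(m : GL (Fin 3) F), hmB⟩ false) = xx.1 := by
      refine Units.ext (Matrix.ext fun i j => ?_)
      rw [reindexGL_symm, coe_reindexGL, Matrix.reindex_apply, Matrix.submatrix_apply]
      simp only [Equiv.symm_symm]
      rw [leviProjection_apply_coe, he, he, hmat]
      fin_cases i <;> fin_cases j <;> rfl
    rw [hdet, hblk]
    rfl
  have hscP : Representation.IsSupercuspidal (Representation.twist (σ₂.comp (MonoidHom.fst (GL (Fin 2) F) (GL (Fin 1) F))) ξ) := by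
    have hA : ∀ a b : GL (Fin 1) F, a * b = b * a := by
      intro a b
      refine Units.ext (Matrix.ext fun i j => ?_)
      fin_cases i; fin_cases j
      simp [Matrix.mul_apply, mul_comm]
    exact Representation.IsSupercuspidal.twist (h := isSupercuspidal_comp_fst hA hsc) (χ := ξ) (hχ := hξo)
  have heq : τ.comp (leviReindexHom F (![false, false, true] : Fin 3 → Bool) (Equiv.refl (Fin 3)) (![0, 0, 1] : Fin 3 → Fin 2) hcc) =
      ((Representation.twist (σ₂.comp (MonoidHom.fst (GL (Fin 2) F) (GL (Fin 1) F))) ξ).comp E.symm.toMulEquiv.toMonoidHom) := by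
    refine MonoidHom.ext fun m => LinearMap.ext fun w => ?_
    have h := hρE (E.symm m) w
    rw [ContinuousMulEquiv.apply_symm_apply] at h
    rw [h]
    rfl
  have hτ''sc : Representation.IsSupercuspidal (τ.comp (leviReindexHom F (![false, false, true] : Fin 3 → Bool) (Equiv.refl (Fin 3))
      (![0, 0, 1] : Fin 3 → Fin 2) hcc)) := by
    rw [heq]
    exact hscP.comp_mulEquiv E.symm.toMulEquiv E.symm.toHomeomorph.isOpenMap
  -- ★ the supercuspidal two-block irreducibility, transported back to the labelling `![f,f,t]`
  have hirr'' := K2E3GL3TwoBlockInducedIrreducible.isIrreducible_parabolicIndGL_twoOne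
    (τ.comp (leviReindexHom F (![false, false, true] : Fin 3 → Bool) (Equiv.refl (Fin 3)) (![0, 0, 1] : Fin 3 → Fin 2) hcc)) hτ''s hτ''sc
  exact (K2E3GL3OuterAutomorphismInduction.isIrreducible_parabolicIndGL_iff_of_continuousMulEquiv F
    (![false, false, true] : Fin 3 → Bool) (![0, 0, 1] : Fin 3 → Fin 2)
    (ContinuousMulEquiv.refl (GL (Fin 3) F)) hP τ _ hcompat).2 hirr''


end Supercuspidal

end Summit.HodgeConjecture.HodgeConjecture.R90.S1

end
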